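import Summits.AtomisticToContinuum.BoseEinsteinCondensation.Theses.BECBathMassLiouville

/-!
# `ResponseLiouvilleGlue` (route BECBathMassLiouville, item stmt-AtomisticToContinuum-14094)

The glue edge of the deciding chain of route `route-AtomisticToContinuum-BECBathMassLiouville`:
the static response bound `StaticResponseBound` (finite compressibility at every wavelength, for
every repulsive finite-range `v`) and the per-potential engine `SpaceTimeLiouville`
(static-response body at `v` → insertion-residue body at `v`) give the target `InsertionResidue`
by instantiating the engine at each admissible `v`. Pure logic.
-/

namespace Summit.AtomisticToContinuum.BoseEinsteinCondensation.Theorems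

open Summit.AtomisticToContinuum.BoseEinsteinCondensation.Theses.BECBathMassLiouville

/-- The glue `StaticResponseBound → SpaceTimeLiouville → InsertionResidue` of route
`BECBathMassLiouville` (item stmt-AtomisticToContinuum-14094): instantiate the per-potential engine
`SpaceTimeLiouville` at each repulsive finite-range `v` on the static-response body supplied by
`StaticResponseBound`. -/
theorem responseLiouvilleGlue_proof : ResponseLiouvilleGlue := by
  unfold ResponseLiouvilleGlue
  intro hK hE v hv
  exact hE v hv (hK v hv)

end Summit.AtomisticToContinuum.BoseEinsteinCondensation.Theorems
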